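import Summits.ValiantsHypothesis.ValiantsHypothesis.Theorems.LacunarySymmetroidMatrixDescartesSeparatedSectorEndpoint

/-!
# `MatrixDescartes` — an EXPLICIT FORMAT FAMILY beyond the census table: balanced geometric ladders of arbitrary
# letters have `Z₊ ≤ m(K−1)`, `Z ≤ 2m(K−1) + 1`, and satisfy the crux's inequality at all fat formats

HONEST FRAMING.  Object-search cell `pub-symmetroid`, crux `Theses.LacunarySymmetroid.MatrixDescartes`
(ledger item `stmt-ValiantsHypothesis-18050`, route `LacunarySymmetroid`; seat `val-sym-mdr-p2`, gen 12).  The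
crux implies `VP ≠ VNP` by the route's assembly; NOTHING here is progress on it and nothing here is a claim
about `VP ≠ VNP`, `DoorA26` / `DoorA34` or the cell's registers.

**THE FAMILY** (`card_posRoots_le_of_geometricLadder`).  Any `K = N + 1 ≥ 2` letters `S 0, …, S N` — arbitrary
real `m × m` matrices with entry bounds `σ_l > 0` and conditioning `|det S l| ≥ η·σ_l^m` — any strictly increasing
exponents `d`, hand-over scales `c j > 0` BALANCING consecutive letters (`σ_(j+1)·c_j^(d (j+1)) = σ_j·c_j^(d j)`), window
half-widths `ρ j` with `ρ_j^(−(d (j+1) − d j)) ≤ ε`, windows `[c_j/ρ_j, c_j ρ_j]` in increasing order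
(`c_j ρ_j ≤ c_(j+1)/ρ_(j+1)`), and the single numerical condition `10ε ≤ 1`, `(m+1)^m·m!·m·3^m·(10ε) < η`.
Then `F = ∑ X^(d l) • S l` has at most `m` positive zeros per hand-over: `Z₊ ≤ N·m = m(K−1)` — the matrix
Descartes count («diagonal» column of Table S) — for every format `(m, K)`; `card_realRoots_le_of_geometricLadder`:
`Z ≤ 2m(K−1) + 1` (the reflection is again a ladder); `geometricLadder_mdr`: the crux's inequality on the family
at all fat formats (`Census.fatFormat_absorb`).  Far letters decay like `ε^distance` along the ladder
(`decay_down` / `decay_up` inside the proof, from the hand-over inequalities `handover_left`, `handover_right`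
and the monotonicity lemmas of the endpoint file), so the weights sum to `≤ 4ε` (`geom_tail_le`) and the endpoint
certificate theorem `card_posRoots_le_of_endpointCert` applies with `ε' = 10ε`.

WHY IT IS NOT TRIVIAL AND WHAT IT IS NOT.  For exponents in arithmetic progression `Z₊ ≤ m(K−1)` follows from the
degree after `x ↦ x^g`; here the exponents are arbitrary (the degree `m·d N` is unbounded) and the letters do not
commute, so neither Descartes (`C(m+K−1,m) − 1`) nor any sector of the tree applies.  The price is the margin
`ε = exp(−O(m log m))·η`, i.e. hand-over ratios `ρ^gap ≥ 10·(m+1)^m·m!·m·3^m/η`: a valuation gap of order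
`m log m + log(1/η)` per step — the separated regime.  The cell's extremal rows live at the opposite end
(overlapping hand-overs).  Sector bookkeeping beside the crux. [folklore]
-/


-- `Summit.ValiantsHypothesis.ValiantsHypothesis.…` repeats a component by the D-0017 layout
-- (single-conjunct summit), which the `dupNamespace` linter flags; the name is mandated.
set_option linter.dupNamespace false

namespace Summit.ValiantsHypothesis.ValiantsHypothesis.Theorems.LacunarySymmetroidMatrixDescartes.Separated

open Polynomial Complex Set Finset
open scoped BigOperators Matrix Real

/-! ## §12 An explicit family: balanced geometric ladders -/

section Ladder

/-- `∑_{i<n} ε^(i+1) ≤ 2ε` for `0 ≤ ε ≤ 1/2`. [folklore] -/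
theorem geom_tail_le {ε : ℝ} (hε0 : 0 ≤ ε) (hε : 2 * ε ≤ 1) (n : ℕ) :
    ∑ i ∈ Finset.range n, ε ^ (i + 1) ≤ 2 * ε := by
  suffices h : ∑ i ∈ Finset.range n, ε ^ (i + 1) ≤ 2 * ε - 2 * ε ^ (n + 1) by
    linarith [pow_nonneg hε0 (n + 1)]
  induction n with
  | zero => simp
  | succ k ih =>
    rw [Finset.sum_range_succ]
    have : ε ^ (k + 2) ≤ ε ^ (k + 1) / 2 := by
      rw [pow_succ]
      have := pow_nonneg hε0 (k + 1)
      nlinarith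
    have e : ε ^ (k + 1 + 1) = ε ^ (k + 2) := rfl
    rw [e]
    linarith

variable {N m : ℕ} (d : Fin (N + 1) → ℕ) (S : Fin (N + 1) → Matrix (Fin m) (Fin m) ℝ) (σ : Fin (N + 1) → ℝ)

/-- Hand-over at the left end of a balanced window: `σ_b (c/ρ)^(d b) ≤ ε σ_a (c/ρ)^(d a)` when
`σ_b c^(d b) = σ_a c^(d a)` and `ρ^(−(d b − d a)) ≤ ε`. [folklore] -/
theorem handover_left {σa σb c ρ ε : ℝ} {da db : ℕ} (hc : 0 < c) (hρ : 0 < ρ) (hab : da ≤ db)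
    (hbal : σb * c ^ db = σa * c ^ da) (hρε : (ρ⁻¹) ^ (db - da) ≤ ε) (hσa : 0 ≤ σa) :
    σb * (c / ρ) ^ db ≤ ε * (σa * (c / ρ) ^ da) := by
  obtain ⟨g, rfl⟩ : ∃ g, db = da + g := ⟨db - da, by omega⟩
  rw [Nat.add_sub_cancel_left] at hρε
  have e : σb * (c / ρ) ^ (da + g) = σa * (c / ρ) ^ da * (ρ⁻¹) ^ g := by
    rw [div_eq_mul_inv, mul_pow, mul_pow, pow_add, pow_add]
    have : σb * c ^ (da + g) = σa * c ^ da := hbal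
    rw [pow_add] at this
    calc σb * (c ^ da * c ^ g * ((ρ⁻¹) ^ da * (ρ⁻¹) ^ g))
        = (σb * (c ^ da * c ^ g)) * ((ρ⁻¹) ^ da * (ρ⁻¹) ^ g) := by ring
      _ = (σa * c ^ da) * ((ρ⁻¹) ^ da * (ρ⁻¹) ^ g) := by rw [this]
      _ = σa * (c ^ da * (ρ⁻¹) ^ da) * (ρ⁻¹) ^ g := by ring
  rw [e]
  have h0 : 0 ≤ σa * (c / ρ) ^ da := mul_nonneg hσa (pow_nonneg (div_pos hc hρ).le _)
  nlinarith

/-- Hand-over at the right end: `σ_a (cρ)^(d a) ≤ ε σ_b (cρ)^(d b)`. [folklore] -/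
theorem handover_right {σa σb c ρ ε : ℝ} {da db : ℕ} (hc : 0 < c) (hρ : 0 < ρ) (hab : da ≤ db)
    (hbal : σb * c ^ db = σa * c ^ da) (hρε : (ρ⁻¹) ^ (db - da) ≤ ε) (hσb : 0 ≤ σb) :
    σa * (c * ρ) ^ da ≤ ε * (σb * (c * ρ) ^ db) := by
  obtain ⟨g, rfl⟩ : ∃ g, db = da + g := ⟨db - da, by omega⟩
  rw [Nat.add_sub_cancel_left] at hρε
  have hρg : ρ ^ g * (ρ⁻¹) ^ g = 1 := by rw [← mul_pow, mul_inv_cancel₀ hρ.ne', one_pow]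
  have e : σa * (c * ρ) ^ da = σb * (c * ρ) ^ (da + g) * (ρ⁻¹) ^ g := by
    rw [mul_pow, mul_pow, pow_add, pow_add]
    have : σb * c ^ (da + g) = σa * c ^ da := hbal
    rw [pow_add] at this
    calc σa * (c ^ da * ρ ^ da) = (σa * c ^ da) * ρ ^ da := by ring
      _ = σb * (c ^ da * c ^ g) * ρ ^ da := by rw [← this]
      _ = σb * (c ^ da * c ^ g) * ρ ^ da * (ρ ^ g * (ρ⁻¹) ^ g) := by rw [hρg, mul_one]
      _ = σb * (c ^ da * c ^ g * (ρ ^ da * ρ ^ g)) * (ρ⁻¹) ^ g := by ring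
  rw [e]
  have h0 : 0 ≤ σb * (c * ρ) ^ (da + g) := mul_nonneg hσb (pow_nonneg (mul_pos hc hρ).le _)
  nlinarith

/-- **EXPLICIT FAMILY: balanced geometric ladders.**  Exponents `d 0 < d 1 < … < d N` (arbitrary, `N ≥ 1`),
letters `S 0, …, S N` with entry bounds `σ_l > 0` and conditioning `|det S l| ≥ η σ_l^m` — otherwise ARBITRARY
(indefinite, non-commuting) — hand-over scales `c j > 0` balancing consecutive letters
(`σ (j+1)·c_j^(d (j+1)) = σ j·c_j^(d j)`), window half-widths `ρ j > 0` with `ρ_j^(−gap) ≤ ε`, windows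
`[c_j/ρ_j, c_j ρ_j]` in increasing order (`c_j ρ_j ≤ c_(j+1)/ρ_(j+1)`), and `10ε ≤ 1`,
`(m+1)^m·m!·m·3^m·(10ε) < η`.  Then `Z₊ ≤ N·m = m(K−1)`: the matrix Descartes count, for every format `(m, K)`.
(Far letters decay geometrically along the ladder — `ε^distance` — so the weights sum to `≤ 4ε`; endpoint
certificate theorem.) [folklore] -/
theorem card_posRoots_le_of_geometricLadder (hN : 0 < N) (hd : StrictMono d)
    (hσ : ∀ l i j, |S l i j| ≤ σ l) (hσpos : ∀ l, 0 < σ l) {η ε : ℝ} (hdet : ∀ l, η * σ l ^ m ≤ |(S l).det|)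
    (hε0 : 0 ≤ ε) (hε1 : 10 * ε ≤ 1) (hεη : ((m : ℝ) + 1) ^ m * (m.factorial : ℝ) * m * 3 ^ m * (10 * ε) < η)
    (c ρ : Fin N → ℝ) (hc : ∀ j, 0 < c j) (hρ : ∀ j, 0 < ρ j)
    (hbal : ∀ j : Fin N, σ j.succ * c j ^ d j.succ = σ j.castSucc * c j ^ d j.castSucc)
    (hρε : ∀ j : Fin N, (ρ j)⁻¹ ^ (d j.succ - d j.castSucc) ≤ ε)
    (hsep : ∀ j j' : Fin N, j'.val = j.val + 1 → c j * ρ j ≤ c j' / ρ j') :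
    ((Matrix.det (∑ l, ((X : ℝ[X]) ^ d l) • (S l).map C)).roots.toFinset.filter (fun t => 0 < t)).card
      ≤ N * m := by
  classical
  have hσ0 : ∀ l, 0 ≤ σ l := fun l => (hσpos l).le
  have hεle : 2 * ε ≤ 1 := by linarith
  -- windows
  set u : Fin N → ℝ := fun j => c j / ρ j with hu_def
  set v : Fin N → ℝ := fun j => c j * ρ j with hv_def
  have hu : ∀ j, 0 < u j := fun j => div_pos (hc j) (hρ j)
  have hab : ∀ j : Fin N, d j.castSucc < d j.succ := fun j => hd (Fin.castSucc_lt_succ (i := j))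
  -- `ρ j > 1` (from `ρ^(−gap) ≤ ε < 1`)
  have hρ1 : ∀ j, 1 < ρ j := by
    intro j
    by_contra hle
    rw [not_lt] at hle
    have hg : 1 ≤ d j.succ - d j.castSucc := by have := hab j; omega
    have h1 : (1 : ℝ) ≤ (ρ j)⁻¹ := (one_le_inv₀ (hρ j)).2 hle
    have h2 : (1 : ℝ) ≤ (ρ j)⁻¹ ^ (d j.succ - d j.castSucc) := one_le_pow₀ h1
    have h3 := hρε j
    linarith
  have huv : ∀ j, u j < v j := by
    intro j
    rw [hu_def, hv_def]; simp only
    rw [div_lt_iff₀ (hρ j)]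
    have h1 := hρ1 j
    have h2 : (1 : ℝ) < ρ j * ρ j := by nlinarith
    have h3 : c j * 1 < c j * (ρ j * ρ j) := mul_lt_mul_of_pos_left h2 (hc j)
    linarith
  -- hand-over inequalities
  have hhand : ∀ j : Fin N, σ j.succ * u j ^ d j.succ ≤ ε * (σ j.castSucc * u j ^ d j.castSucc) ∧
      σ j.castSucc * v j ^ d j.castSucc ≤ ε * (σ j.succ * v j ^ d j.succ) := fun j =>
    ⟨handover_left (hc j) (hρ j) (hab j).le (hbal j) (hρε j) (hσ0 _),
     handover_right (hc j) (hρ j) (hab j).le (hbal j) (hρε j) (hσ0 _)⟩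
  -- monotone windows: `v j ≤ u j'` and hence `v i ≤ v j`, `u i ≤ u j` for `i ≤ j`
  have hvu : ∀ j j' : Fin N, j'.val = j.val + 1 → v j ≤ u j' := fun j j' h => hsep j j' h
  have hvmono : ∀ i j : Fin N, i.val ≤ j.val → v i ≤ v j := by
    intro i j hij
    obtain ⟨k, hk⟩ : ∃ k, j.val = i.val + k := ⟨j.val - i.val, by omega⟩
    induction k generalizing j with
    | zero => rw [show j = i from Fin.ext (by omega)]
    | succ k ih =>
      have hj1 : i.val + k < N := by omega
      set j₁ : Fin N := ⟨i.val + k, hj1⟩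
      exact (ih j₁ (by simp [j₁]) (by simp [j₁])).trans
        ((hvu j₁ j (by simp [j₁]; omega)).trans (huv j).le)
  have humono : ∀ i j : Fin N, i.val ≤ j.val → u i ≤ u j := by
    intro i j hij
    rcases Nat.eq_or_lt_of_le hij with h | h
    · rw [show i = j from Fin.ext h]
    · have hj1 : j.val - 1 < N := by omega
      set j₁ : Fin N := ⟨j.val - 1, hj1⟩
      exact ((huv i).le.trans (hvmono i j₁ (by simp [j₁]; omega))).trans (hvu j₁ j (by simp [j₁]; omega))
  -- chain steps
  have step_down : ∀ (i : Fin N) (x : ℝ), v i ≤ x →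
      σ i.castSucc * x ^ d i.castSucc ≤ ε * (σ i.succ * x ^ d i.succ) := fun i x hx =>
    small_of_small_at_left (hσ0 _) ((hu i).trans (huv i)) hx (hab i).le (hhand i).2
  have step_up : ∀ (i : Fin N) (x : ℝ), 0 < x → x ≤ u i →
      σ i.succ * x ^ d i.succ ≤ ε * (σ i.castSucc * x ^ d i.castSucc) := fun i x hx0 hx =>
    small_of_small_at_right (hσ0 _) hx0 hx (hab i).le (hhand i).1
  -- geometric decay below: for `x ≥ v (j-1)`, letters `l < j` satisfy `σ_l x^(d l) ≤ ε^(j-l) σ_j x^(d j)`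
  have decay_down : ∀ (k : ℕ) (l j : Fin (N + 1)) (x : ℝ), j.val = l.val + k → 1 ≤ k →
      (∀ i : Fin N, l.val ≤ i.val → i.val < j.val → v i ≤ x) →
      σ l * x ^ d l ≤ ε ^ k * (σ j * x ^ d j) := by
    intro k
    induction k with
    | zero => intro l j x h hk; omega
    | succ k ih =>
      intro l j x hj _ hvx
      have hjN : l.val + k < N := by have := j.isLt; omega
      set i : Fin N := ⟨l.val + k, hjN⟩ with hi
      have hi1 : i.castSucc = (⟨l.val + k, by omega⟩ : Fin (N + 1)) := rfl
      have hi2 : i.succ = j := Fin.ext (by simp [hi]; omega)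
      have hstep := step_down i x (hvx i (by simp [hi]) (by simp [hi]; omega))
      rw [hi2] at hstep
      rcases Nat.eq_zero_or_pos k with hk0 | hk0
      · subst hk0
        have : l = i.castSucc := Fin.ext (by simp [hi])
        rw [this, zero_add, pow_one]
        exact hstep
      · have hmid := ih l i.castSucc x (by simp [hi]) hk0
          (fun i' h1 h2 => hvx i' h1 (by simp [hi] at h2; omega))
        calc σ l * x ^ d l ≤ ε ^ k * (σ i.castSucc * x ^ d i.castSucc) := hmid
          _ ≤ ε ^ k * (ε * (σ j * x ^ d j)) := mul_le_mul_of_nonneg_left hstep (pow_nonneg hε0 _)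
          _ = ε ^ (k + 1) * (σ j * x ^ d j) := by ring
  -- geometric decay above: for `0 < x ≤ u j`, letters `l > j` satisfy `σ_l x^(d l) ≤ ε^(l-j) σ_j x^(d j)`
  have decay_up : ∀ (k : ℕ) (j l : Fin (N + 1)) (x : ℝ), l.val = j.val + k → 1 ≤ k → 0 < x →
      (∀ i : Fin N, j.val ≤ i.val → i.val < l.val → x ≤ u i) →
      σ l * x ^ d l ≤ ε ^ k * (σ j * x ^ d j) := by
    intro k
    induction k with
    | zero => intro j l x h hk; omega
    | succ k ih =>
      intro j l x hl _ hx0 hxu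
      have hiN : j.val + k < N := by have := l.isLt; omega
      set i : Fin N := ⟨j.val + k, hiN⟩ with hi
      have hi2 : i.succ = l := Fin.ext (by simp [hi]; omega)
      have hstep := step_up i x hx0 (hxu i (by simp [hi]) (by simp [hi]; omega))
      rw [hi2] at hstep
      rcases Nat.eq_zero_or_pos k with hk0 | hk0
      · subst hk0
        have : j = i.castSucc := Fin.ext (by simp [hi])
        rw [this, zero_add, pow_one]
        exact hstep
      · have hmid := ih j i.castSucc x (by simp [hi]) hk0 hx0
          (fun i' h1 h2 => hxu i' h1 (by simp [hi] at h2; omega))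
        calc σ l * x ^ d l ≤ ε * (σ i.castSucc * x ^ d i.castSucc) := hstep
          _ ≤ ε * (ε ^ k * (σ j * x ^ d j)) := mul_le_mul_of_nonneg_left hmid hε0
          _ = ε ^ (k + 1) * (σ j * x ^ d j) := by ring
  -- weights
  set κ : Fin N → Fin (N + 1) → ℝ := fun j l =>
    if l.val < j.val then ε ^ (j.val - l.val) else if j.val + 1 < l.val then ε ^ (l.val - j.val - 1) else 0
    with hκ
  have hκ0 : ∀ j l, 0 ≤ κ j l := by
    intro j l; rw [hκ]; simp only; split_ifs <;> positivity
  have hκsum : ∀ j, ∑ l, κ j l ≤ 4 * ε := by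
    intro j
    have hsplit : ∀ l : Fin (N + 1), κ j l ≤
        (if l.val < j.val then ε ^ (j.val - l.val) else 0) +
        (if j.val + 1 < l.val then ε ^ (l.val - j.val - 1) else 0) := by
      intro l; rw [hκ]; simp only
      split_ifs <;> linarith [pow_nonneg hε0 (j.val - l.val), pow_nonneg hε0 (l.val - j.val - 1)]
    refine (Finset.sum_le_sum fun l _ => hsplit l).trans ?_
    rw [Finset.sum_add_distrib]
    -- the two tails, through `range`
    have h1 : ∑ l : Fin (N + 1), (if l.val < j.val then ε ^ (j.val - l.val) else (0 : ℝ)) ≤ 2 * ε := by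
      rw [Fin.sum_univ_eq_sum_range (fun t => if t < j.val then ε ^ (j.val - t) else (0 : ℝ)) (N + 1)]
      have hjN : j.val ≤ N + 1 := by have := j.isLt; omega
      calc ∑ t ∈ Finset.range (N + 1), (if t < j.val then ε ^ (j.val - t) else (0 : ℝ))
          = ∑ t ∈ Finset.range j.val, ε ^ (j.val - t) := by
            rw [← Finset.sum_range_add_sum_Ico _ hjN]
            have hz : ∑ t ∈ Finset.Ico j.val (N + 1), (if t < j.val then ε ^ (j.val - t) else (0 : ℝ)) = 0 :=
              Finset.sum_eq_zero fun t ht => by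
                rw [Finset.mem_Ico] at ht; rw [if_neg (by omega)]
            rw [hz, add_zero]
            exact Finset.sum_congr rfl fun t ht => by rw [Finset.mem_range] at ht; rw [if_pos ht]
        _ = ∑ i ∈ Finset.range j.val, ε ^ (i + 1) := by
            rw [← Finset.sum_range_reflect (fun i => ε ^ (i + 1)) j.val]
            exact Finset.sum_congr rfl fun t ht => by
              rw [Finset.mem_range] at ht; congr 1; omega
        _ ≤ 2 * ε := geom_tail_le hε0 hεle _
    have h2 : ∑ l : Fin (N + 1), (if j.val + 1 < l.val then ε ^ (l.val - j.val - 1) else (0 : ℝ)) ≤ 2 * ε := by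
      rw [Fin.sum_univ_eq_sum_range (fun t => if j.val + 1 < t then ε ^ (t - j.val - 1) else (0 : ℝ)) (N + 1)]
      have hjN : j.val + 2 ≤ N + 1 := by have := j.isLt; omega
      calc ∑ t ∈ Finset.range (N + 1), (if j.val + 1 < t then ε ^ (t - j.val - 1) else (0 : ℝ))
          = ∑ t ∈ Finset.Ico (j.val + 2) (N + 1), ε ^ (t - j.val - 1) := by
            rw [← Finset.sum_range_add_sum_Ico _ hjN]
            have hz : ∑ t ∈ Finset.range (j.val + 2), (if j.val + 1 < t then ε ^ (t - j.val - 1) else (0 : ℝ)) = 0 :=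
              Finset.sum_eq_zero fun t ht => by
                rw [Finset.mem_range] at ht; rw [if_neg (by omega)]
            rw [hz, zero_add]
            exact Finset.sum_congr rfl fun t ht => by rw [Finset.mem_Ico] at ht; rw [if_pos (by omega)]
        _ = ∑ i ∈ Finset.range (N + 1 - (j.val + 2)), ε ^ (i + 1) := by
            rw [Finset.sum_Ico_eq_sum_range]
            exact Finset.sum_congr rfl fun i _ => by congr 1; omega
        _ ≤ 2 * ε := geom_tail_le hε0 hεle _
    linarith
  -- apply the endpoint certificate theorem with `Λ = 4ε`
  have hε1' : 2 * ε + 2 * (4 * ε) ≤ 1 := by linarith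
  have hεη' : ((m : ℝ) + 1) ^ m * (m.factorial : ℝ) * m * 3 ^ m * (2 * ε + 2 * (4 * ε)) < η := by
    have : 2 * ε + 2 * (4 * ε) = 10 * ε := by ring
    rw [this]; exact hεη
  refine card_posRoots_le_of_endpointCert d S σ hσ hσpos hdet hε0 (by positivity) hε1' hεη' hN
    (fun j => j.castSucc) (fun j => j.succ) hab u v hu huv ?_ ?_ ?_ hhand κ hκ0 hκsum ?_
  · -- chain
    intro j j' h
    exact ⟨Fin.ext (by simp; omega), hvu j j' h⟩
  · -- lowest letter
    intro l
    refine hd.monotone ?_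
    rw [Fin.le_def]; simp
  · -- highest letter
    intro l
    refine hd.monotone ?_
    rw [Fin.le_def]; simp; omega
  · -- the other letters at the window ends
    intro j l hla hlb
    have hla' : l.val ≠ j.val := fun h => hla (Fin.ext (by simp [h]))
    have hlb' : l.val ≠ j.val + 1 := fun h => hlb (Fin.ext (by simp [h]))
    rcases lt_or_gt_of_ne hla' with hlt | hgt
    · -- `l` below `a j = j`
      left
      refine ⟨hd (by rw [Fin.lt_def]; simp [hlt]), ?_⟩
      have hκl : κ j l = ε ^ (j.val - l.val) := by rw [hκ]; simp only; rw [if_pos hlt]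
      rw [hκl]
      refine decay_down (j.val - l.val) l j.castSucc (u j) (by simp; omega) (by omega) ?_
      intro i hli hij
      simp at hij
      -- `v i ≤ u j` for `i < j`
      have hj1 : j.val - 1 < N := by omega
      set j₁ : Fin N := ⟨j.val - 1, hj1⟩
      exact (hvmono i j₁ (by simp [j₁]; omega)).trans (hvu j₁ j (by simp [j₁]; omega))
    · -- `l` above `b j = j+1`
      right
      have hgt' : j.val + 1 < l.val := by omega
      refine ⟨hd (by rw [Fin.lt_def]; simp; omega), ?_⟩
      have hκl : κ j l = ε ^ (l.val - j.val - 1) := by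
        rw [hκ]; simp only; rw [if_neg (by omega), if_pos hgt']
      rw [hκl]
      refine decay_up (l.val - j.val - 1) j.succ l (v j) (by simp; omega) (by omega)
        ((hu j).trans (huv j)) ?_
      intro i hji hil
      simp at hji
      -- `v j ≤ u i` for `i > j`
      have hi1 : j.val + 1 < N := by have := i.isLt; omega
      set j₁ : Fin N := ⟨j.val + 1, hi1⟩
      exact (hvu j j₁ (by simp [j₁])).trans (humono j₁ i (by simp [j₁]; omega))

/-- All real zeros of a balanced geometric ladder: the reflected pencil `S l ↦ (−1)^(d l) S l` is again one
(same `σ`, same `|det|`, same scales), so `Z ≤ 2·N·m + 1`. [folklore] -/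
theorem card_realRoots_le_of_geometricLadder (hN : 0 < N) (hd : StrictMono d)
    (hσ : ∀ l i j, |S l i j| ≤ σ l) (hσpos : ∀ l, 0 < σ l) {η ε : ℝ} (hdet : ∀ l, η * σ l ^ m ≤ |(S l).det|)
    (hε0 : 0 ≤ ε) (hε1 : 10 * ε ≤ 1) (hεη : ((m : ℝ) + 1) ^ m * (m.factorial : ℝ) * m * 3 ^ m * (10 * ε) < η)
    (c ρ : Fin N → ℝ) (hc : ∀ j, 0 < c j) (hρ : ∀ j, 0 < ρ j)
    (hbal : ∀ j : Fin N, σ j.succ * c j ^ d j.succ = σ j.castSucc * c j ^ d j.castSucc)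
    (hρε : ∀ j : Fin N, (ρ j)⁻¹ ^ (d j.succ - d j.castSucc) ≤ ε)
    (hsep : ∀ j j' : Fin N, j'.val = j.val + 1 → c j * ρ j ≤ c j' / ρ j') :
    (Matrix.det (∑ l, ((X : ℝ[X]) ^ d l) • (S l).map C)).roots.toFinset.card ≤ 2 * (N * m) + 1 := by
  have hS' : ∀ l i j, |(((-1 : ℝ) ^ d l) • S l) i j| ≤ σ l := by
    intro l i j
    rw [Matrix.smul_apply, smul_eq_mul, abs_mul, abs_pow, abs_neg, abs_one, one_pow, one_mul]
    exact hσ l i j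
  have hdet' : ∀ l, |(((-1 : ℝ) ^ d l) • S l).det| = |(S l).det| := by
    intro l
    rw [Matrix.det_smul, abs_mul, abs_pow, abs_pow, abs_neg, abs_one, one_pow, one_pow, one_mul]
  have h1 := card_posRoots_le_of_geometricLadder d S σ hN hd hσ hσpos hdet hε0 hε1 hεη c ρ hc hρ hbal hρε hsep
  have h2 := card_posRoots_le_of_geometricLadder d (fun l => ((-1 : ℝ) ^ d l) • S l) σ hN hd hS' hσpos
    (fun l => by rw [hdet']; exact hdet l) hε0 hε1 hεη c ρ hc hρ hbal hρε hsep
  have h3 := stub_negRoots (N + 1) m d S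
  omega

/-- **The crux's inequality on the geometric-ladder family, at all fat formats.**  For all `c₀, q` there is
`K₀` such that for every format `(m, K)` with `K ≥ K₀`, `m ≤ 2^((⌊log₂K⌋+c₀)^c₀)`, every balanced geometric
ladder with `K = N + 1` letters (hypotheses as in `card_posRoots_le_of_geometricLadder`) satisfies
`Z^q ≤ 2^(K⌊log₂K⌋)`.  An explicit infinite family of NON-commuting, indefinite, full-rank pencils at every
format — beside the crux, not inside its difficulty. [folklore] -/
theorem geometricLadder_mdr (c₀ q : ℕ) : ∃ K₀ : ℕ, ∀ N m : ℕ, K₀ ≤ N + 1 → m ≤ 2 ^ ((Nat.log 2 (N + 1) + c₀) ^ c₀) →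
    0 < N → ∀ (d : Fin (N + 1) → ℕ) (S : Fin (N + 1) → Matrix (Fin m) (Fin m) ℝ) (σ : Fin (N + 1) → ℝ)
      (η ε : ℝ) (c ρ : Fin N → ℝ), StrictMono d → (∀ l i j, |S l i j| ≤ σ l) → (∀ l, 0 < σ l) →
      (∀ l, η * σ l ^ m ≤ |(S l).det|) → 0 ≤ ε → 10 * ε ≤ 1 →
      ((m : ℝ) + 1) ^ m * (m.factorial : ℝ) * m * 3 ^ m * (10 * ε) < η →
      (∀ j, 0 < c j) → (∀ j, 0 < ρ j) →
      (∀ j : Fin N, σ j.succ * c j ^ d j.succ = σ j.castSucc * c j ^ d j.castSucc) →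
      (∀ j : Fin N, (ρ j)⁻¹ ^ (d j.succ - d j.castSucc) ≤ ε) →
      (∀ j j' : Fin N, j'.val = j.val + 1 → c j * ρ j ≤ c j' / ρ j') →
      (Matrix.det (∑ l, ((X : ℝ[X]) ^ d l) • (S l).map C)).roots.toFinset.card ^ q
        ≤ 2 ^ ((N + 1) * Nat.log 2 (N + 1)) := by
  obtain ⟨K₀, hK₀⟩ := Census.fatFormat_absorb 2 c₀ q
  refine ⟨K₀, fun N m hK hm hN d S σ η ε c ρ hd hσ hσpos hdet hε0 hε1 hεη hc hρ hbal hρε hsep =>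
    hK₀ (N + 1) m _ hK hm ?_⟩
  have h := card_realRoots_le_of_geometricLadder d S σ hN hd hσ hσpos hdet hε0 hε1 hεη c ρ hc hρ hbal hρε hsep
  have h2 : 2 * (N * m) + 1 ≤ 2 ^ 2 * (m + 1) * (N + 1 + 1) := by nlinarith
  exact h.trans h2

end Ladder


end Summit.ValiantsHypothesis.ValiantsHypothesis.Theorems.LacunarySymmetroidMatrixDescartes.Separated
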